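import Literature.AnabelianGeometry.EtaleTheta.Discharge.Sec1GJNTransport
import HarnessLib

/-!
# [EtTh] Thm. 1.6 (iii): the K3 end-knit with the `Z_N`-covering inputs reduced to the origin clause
# `GtpZNFromSplitting` and strong completeness of `G_{ℚ_p}`

Mochizuki, *The étale theta function and its Frobenioid-theoretic manifestations*, Publ. RIMS **45**
(2009), Thm. 1.6 (iii) p. 25; §1 p. 14 (construction of `Z_N`) [cite: MochizukiEtTh2009, Thm 1.6 (iii) p.25].

abc-iut cell, layer L2, seat abc-iut-L2-t1 (§1 ROOT owner, gen 6). PROOF-ONLY knit (no definition, no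
`Prop`-valued definition, no new named fact) over this seat's `Sec1ZNSplittingOfCuspSection` (p456637:
`Thm16Sub.thm16iii_of_prop15iiiInv_of_cuspSection`, taking the `G_{J_N}`-membership transport haugJN at
every level) and `Sec1GJNTransport` (p459263: `haugJN_of_haugN` — haugJN from the `G_{K_N}`-membership
transport and strong completeness of `G_{ℚ_p}`), consumed BY NAME.

* **`Thm16Sub.thm16iii_of_prop15iiiInv_of_cuspSection_of_stronglyComplete`** — [EtTh] Thm. 1.6 (iii)
  (`ThetaSetting.Thm16iii γ h c Eα Eβ hCβ`) with the covering binders hYN / hZN / haugJN ALL eliminated: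
  the `Z_N`-side inputs of the whole chain are now the origin clause `GtpZNFromSplitting` on both sides
  at every level and STRONG COMPLETENESS of `G_{ℚ_p}` («every finite-index subgroup is open», explicit
  hypothesis; the tree's Nikolov–Segal instance under topological finite generation of `G_{ℚ_p}`), next
  to the `Y_N`-side inputs (leaf L02 `hY`, leaf L04 `haugN`, R2 on both sides, [SemiAnbd] Thm. 6.5 (iii),
  one cusp section on the `α` side) and the unchanged Prop. 1.5 / valuation / cusp-evaluation inputs of
  `thm16iii_of_prop15iiiInv` (p445347).

HONEST FRAMING: [EtTh] is refereed; nothing asserted; typed ≠ proved; nothing here bears on [IUTchIII]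
Cor. 3.12.
-/

noncomputable section

namespace Literature.AnabelianGeometry.EtaleTheta

open Literature.AnabelianGeometry.SemiGraphs

namespace Thm16Sub

variable {p : ℕ} [Fact p.Prime] {Dα Dβ : ThetaSetting p} {γ : Dα.PiTemp ≃ₜ* Dβ.PiTemp}

/-- **[EtTh] Theorem 1.6 (iii), K3 end-knit v4**: as `thm16iii_of_prop15iiiInv_of_cuspSection` with the
`G_{J_N}`-membership transport at every level supplied by `haugJN_of_haugN` from strong completeness of
`G_{ℚ_p}`. [cite: MochizukiEtTh2009, Thm 1.6 (iii) p.25] -/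
theorem thm16iii_of_prop15iiiInv_of_cuspSection_of_stronglyComplete (h : ThetaSetting.Thm16i γ)
    (c : ThetaSetting.ThetaCompanion γ)
    (hΔ : Dα.DeltaTemp.map γ.toMulEquiv.toMonoidHom = Dβ.DeltaTemp)
    (hY : Dα.GtpY.map γ.toMulEquiv.toMonoidHom = Dβ.GtpY)
    (haugN : ∀ (N : ℕ+) (g : Dα.PiTemp), Dβ.aug (γ.toMulEquiv g) ∈ Dβ.GKN N ↔ Dα.aug g ∈ Dα.GKN N)
    (hsc : ∀ H : Subgroup (GQp p), H.FiniteIndex → IsOpen (H : Set (GQp p)))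
    (hcuspα : ∀ N, GtpYNFromCusp Dα N) (hcuspβ : ∀ N, GtpYNFromCusp Dβ N)
    (h65 : Dα.IsoPreservesCuspidalDecomp Dβ.toTemperedCurve)
    {Dc : Subgroup Dα.PiTemp} (hDc : Dα.IsCuspidalDecompositionGroup Dc) (hDcY : Dc ≤ Dα.GtpY)
    (s : GQp p →* Dα.PiTemp) (hsec : ∀ g : GQp p, g ∈ Dα.GK → Dα.aug (s g) = g) (hsD : Dα.GK.map s ≤ Dc)
    (hzα : ∀ N, Dα.GtpZNFromSplitting N) (hzβ : ∀ N, Dβ.GtpZNFromSplitting N)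
    (Eα : Dα.EtaleThetaData) (Eβ : Dβ.EtaleThetaData) (hCα : Dα.Compat) (hCβ : Dβ.Compat)
    (hSβ : Dβ.Sec2Hyps) (h15iiα : ThetaSetting.Prop15ii Eα.toKummerData hCα)
    (h15ii : ThetaSetting.Prop15ii Eβ.toKummerData hCβ)
    (h15α : ThetaSetting.Prop15iii Eα hCα) (h15β : ThetaSetting.Prop15iii Eβ hCβ)
    {σ : Dβ.PiTemp} (hσ : σ ∈ Dβ.GtpYdd)
    (Vα : ThetaSetting.ValuationHatData Dα Eα.toKummerData)
    (Vβ : ThetaSetting.ValuationHatData Dβ Eβ.toKummerData)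
    (hVα : Vα.unitsHat = Dα.unitsOKdd.map Eα.toKddHat) (hVβ : Vβ.unitsHat = Dβ.unitsOKdd.map Eβ.toKddHat)
    (h16ii : ThetaSetting.Thm16ii γ h Eα.toKummerData Eβ.toKummerData Vα Vβ)
    (hTβ : Dβ.HasThetaTopology) (hOβ : Dβ.IsEtThOrigin)
    {lamβ : ↥((Dβ.DtpYddN 1).map Dβ.toTheta) →ₜ* Dβ.DeltaTheta} (hstdβ : ThetaSetting.IsStdLog lamβ)
    (hresβ : ContH1.res (MonoidHom.id Dβ.GtpTheta) Dβ.DeltaTheta Dβ.map_toTheta_DtpYddN_one_le Eβ.logUdd =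
      ThetaSetting.homClass ThetaSetting.dtpYddTheta_le_deltaTheta_map lamβ)
    {ια : Dα.PiTemp ≃ₜ* Dα.PiTemp} (hια : Dα.IsInversionAut ια) (cα : ThetaSetting.ThetaCompanion ια)
    (hInvα : ThetaSetting.InvClauses Eα hια cα)
    (cβ : ThetaSetting.ThetaCompanion ((γ.symm.trans ια).trans γ))
    (h15invβ : Dβ.Prop15iiiInvAnchored Eβ)
    (yβ : ThetaSetting.CuspidalPointDd Eβ.toKummerData) (hyβA : yβ.IsAnchored) (hyβ0 : yβ.IsOnLabelZero)
    (hyβfix : Dβ.FixesCuspBelow ((γ.symm.trans ια).trans γ) yβ)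
    (y : ThetaSetting.CuspidalPointDd Eβ.toKummerData) {u₁ u₂ v₁ v₂ : (↥Dβ.Kdd)ˣ}
    (hu₁ : u₁ ∈ Dβ.unitsOKdd) (hu₂ : u₂ ∈ Dβ.unitsOKdd)
    (hv : ‖((v₁ : Dβ.Kdd) : PadicAlgCl p)‖ = ‖((v₂ : Dβ.Kdd) : PadicAlgCl p)‖)
    (h₁ : haveI := hCβ.GtpYdd_normal
      y.evalAt (ContH1.res Dβ.toTheta Dβ.DeltaTheta (y.sec_le.trans y.Dpt_le)
        (ContH1.conj Dβ.toTheta Dβ.DeltaTheta σ Eβ.etaDd)) = Eβ.toKddHat (u₁ * v₁))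
    (h₂ : y.evalAt (ContH1.res Dβ.toTheta Dβ.DeltaTheta (y.sec_le.trans y.Dpt_le)
        (ThetaSetting.transport c h Eα.etaDd)) = Eβ.toKddHat (u₂ * v₂)) :
    ThetaSetting.Thm16iii γ h c Eα Eβ hCβ :=
  thm16iii_of_prop15iiiInv_of_cuspSection h c hΔ hY haugN
    (fun N g => haugJN_of_haugN Dα Dβ γ hΔ N (haugN N) hsc g) hcuspα hcuspβ h65 hDc hDcY s hsec hsD hzα hzβ
    Eα Eβ hCα hCβ hSβ h15iiα h15ii h15α h15β hσ Vα Vβ hVα hVβ h16ii hTβ hOβ hstdβ hresβ hια cα hInvα cβ h15invβ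
    yβ hyβA hyβ0 hyβfix y hu₁ hu₂ hv h₁ h₂

end Thm16Sub

end Literature.AnabelianGeometry.EtaleTheta

end
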